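import Literature.MathematicalPhysics.QuantumLattice.TorusLimitParticleHole
import Literature.MathematicalPhysics.QuantumLattice.SectorGroundStateParticleHolePair
import Literature.MathematicalPhysics.QuantumLattice.HubbardNNNHoppingTorusLimitCorrelator
import Literature.MathematicalPhysics.QuantumLattice.HubbardNNNHoppingEnergyDensityParticleHole
import HarnessLib

/-!
# Torus-limit sector GROUND STATES under the particle–hole transformation: the record `T = 0` class at `(t, t', U, n)`
# along even tori is carried onto the record class of `H(t, -t', U)` at density `2 - n`

Family `hubbard` (topic `MathematicalPhysics/QuantumLattice`); seat `hubbard-downfold-unc-2` (cell `pub/hubbard-downfold`, row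
«FILLING direction of BOX → WORD»: the electron-doped half `n > 1` at `T = 0`). The `T = 0` twin of `TorusSectorGibbsParticleHole` /
`TorusSectorGibbsParticleHoleDictionary` (thermal class), built on `TorusLimitParticleHole` (`IsTorusLimitOf.particleHole`: torus limits
of `N`-particle families along eventually-even sides go to torus limits of the transformed families under `ω ↦ ω ∘ α`). The `T = 0`
CONVENTION OF RECORD of the material-oracle programme binds
`∀ ω Ls ψ, Ls → ∞ → (∀ j, IsGroundStateInSector (hubbardTorusTT' (Ls j) t t' U) (rectN n (Ls j)) 0 (ψ (Ls j))) → (∀ j, ‖ψ (Ls j)‖ = 1) →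
ω.IsTorusLimitOf ψ Ls → W ω` (e.g. `forall_torusLimit_diagHop_le_tchord`).

* (§1 of the companion `SectorGroundStateParticleHolePair`, any finite site set, any PAIR `P H Pᴴ = H' - U N + c`: `Pᴴ` carries unit
  ground states of `H'` in `(N, S^z = M)` to unit ground states of `H` in `(2|Λ| - N, -M)`, sector energies shift by `c - U N`.)
* §1 (even torus, `N ≤ 2L²`, any `M`): unit ground states of `hubbardTorusTT' L t t' U` in `(N, M)` go to unit ground states of
  `hubbardTorusTT' L t (-t') U` in `(2L² - N, -M)` (`isGroundStateInSector_particleHole_hubbardTorusTT'`); complementarity of the record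
  sectors, `halfRectN (2 - n) L + halfRectN n L = L²` whenever `nL²/2 ∈ ℤ` (`halfRectN_two_sub_add_of_eq`, `rectN_two_sub_add_of_eq`).
* §2 THE CLASS STATEMENT (`0 ≤ n ≤ 2`, `Ls → ∞` eventually even with complementary record sectors): for every torus limit `ω` of unit
  `(rectN n L, 0)`-sector ground states of `H_L(t, t', U)` there is a family `ψ'` of unit `(rectN (2 - n) L, 0)`-sector ground states
  of `H_L(t, -t', U)` (EVERY `L`; `ψ' L = P_Lᴴ ψ L` on the good sides) with `(ω ∘ α).IsTorusLimitOf ψ' Ls`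
  (`IsTorusLimitOf.particleHole_of_sectorGroundStates`); hence **every word stated for the record class at `(t, -t', U, 2 - n)` reads on
  `ω ∘ α`** (`IsTorusLimitOf.forall_particleHole_of_sectorGroundStates`, `…_of_frequently`: only eventually-odd `Ls` are excluded).
* §3 THE DICTIONARY: `ρ(ω ∘ α) = 2 - n`; for `U ≥ 0`, `0 < n < 2`: `e_{Φ(t,-t',U)}(ω ∘ α) = e(t, -t', U, 2 - n) = e_{Φ(t,t',U)}(ω) + U(1 - n)`
  (`energyDensityTT'_particleHole` read on both classes) and the transport of energy windows. The observable side of the dictionary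
  (`n ↦ 1 - n`, docc, hopping words) is `InfVolFermionStateParticleHole` §3 / `TorusLimitParticleHole` §4.

USE (electron-doped validation materials NCCO #20, T′ M55/M56, SLCO #37 at `(t' < 0, n > 1)`): a `T = 0` word certified for the record
class at the particle–hole IMAGE point `(1, -s, u, 2 - n_e)` (hole-doped, `t' = +|s|` — the image columns the certifier runs) is a word
about `ω ∘ α` for every torus-limit ground state `ω` of the electron-doped class at `(1, s, u, n_e)` along eventually-even `Ls` with
`n_e (Ls j)²/2 ∈ ℤ` (flag «PH-transported, even-tori subsequence», ruling R-co of the cell lead 2026-08-27).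
HONEST LIMITS: even tori only (odd tori are not bipartite; the record class quantifies over all `Ls`, so the words obtained bind the
sub-class «`Ls` eventually even with `nL²/2 ∈ ℤ`»); no ensemble statement; no number. Everything is PROVED; no definition, no sorry.

## References
* E. H. Lieb, F. Y. Wu, Physica A 321 (2003) 1, §1 eq. (3) (`E(M, M') = -(N_a - N)U + E(N_a - M, N_a - M')`). [cite: LiebWuPhysicaA2003, §1 eq. (3)]
* E. H. Lieb, PRL 62 (1989) 1201, Theorem 2 and Remark (2). [cite: LiebPRL1989, Remark (2)]
* F. H. L. Essler et al. (2005), §2.2.4 eqs. (2.59)–(2.61). [cite: EsslerEtAl2005, §2.2.4 eqs. (2.59)–(2.61)]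
* H. Tasaki (2020), §9.3.3. [cite: Tasaki2020, §9.3.3]
* D. Ruelle, *Statistical Mechanics: Rigorous Results* (1969), §3.3–§3.4 (energy density, its attainment). [cite: Ruelle1969, §3.3]
* O. Bratteli, D. W. Robinson, *OAQSM I* (1987) §4.3.1. [cite: BratteliRobinsonI1987, §4.3.1 (PDF pp. 373–375)]

## Mathlib / tree search
REUSED: `IsTorusLimitOf.particleHole/comp_tendsto/congr_family` (`TorusLimitParticleHole`); `isGroundStateInSector_conjTranspose_particleHole_mulVec_of_conj`,
`star_conjTranspose_particleHole_mulVec_dotProduct` (`SectorGroundStateParticleHolePair`); `particleHole_hubbardTorusTT'` (`HubbardNNNHoppingParticleHole`); `exists_unit_isGroundStateInSector_hubbardTorusTT'`,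
`IsTorusLimitOf.meanEnergy_hubbardTTPrime_eq_energyDensityTT'` (`HubbardNNNHoppingTorusLimitCorrelator`); `IsTorusLimitOf.density_eq_of_rectN`
(`InfVolFermionStateDensity`); `energyDensityTT'_particleHole` (`HubbardNNNHoppingEnergyDensityParticleHole`); `density_particleHole`
(`InfVolFermionStateParticleHole`); `particleHole_mul_numberAt_mul_conjTranspose_holds`, `particleHole_(conjTranspose_)mulVec_apply`,
`particleHole_mul_conjTranspose`, `particleHole_conjTranspose_mul`, `card_orb`, `totalNumber_mulVec_of_isNParticle`
(`HubbardModelParticleHoleProofs`); `LiebThm1.neg_sum_norm_le_re_expect`; `OrderIso.map_csInf'`, `extraction_of_frequently_atTop` (Mathlib).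
The joint-sector transfer existed only Summits-side (`Summits/HubbardSuperconductivity/HubbardLadder/PairCorrParticleHoleSectors.lean`,
`…/Theorems/SoloBlindParticleHoleSectors.lean`); `lean search 'IsTorusLimitOf.*particleHole|isGroundStateInSector_particleHole'` under
`Literature/`: nothing before this file.
-/

noncomputable section

namespace Literature.MathematicalPhysics.QuantumLattice

open Matrix Finset HubbardWave0 Literature.Probability.LatticeModels ThermodynamicLimit
open _root_.Filter
open scoped _root_.Topology ComplexOrder BigOperators

section TorusPrivate

variable {L : ℕ}

/-- `|(ℤ/Lℤ)²| = L²` (in this file's instance context). [folklore] -/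
private theorem card_fermionTorus_two' (L : ℕ) : Fintype.card (FermionTorus 2 L) = L ^ 2 := by
  simp [FermionTorus, Fintype.card_lex]

/-- The particle–hole phases of the torus are unimodular. [folklore] -/
private theorem norm_torusPhase (i : Orb (FermionTorus 2 L)) : ‖((torusStagger (ofLex i).1 : ℤ) : ℂ)‖ = 1 :=
  norm_intCast_units _

end TorusPrivate

/-! ### §1 The even torus: sector ground states of `H_L(t, t', U)` go to sector ground states of `H_L(t, -t', U)` -/

section TorusGroundStates

variable {L : ℕ}

/-- The torus conjugation identity `P H_L(t, -t', U) Pᴴ = H_L(t, t', U) - U N + U L²` (`L` even), restated from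
`particleHole_hubbardTorusTT'` in the instance context of this file. [cite: EsslerEtAl2005, §2.2.4 eqs. (2.59)–(2.61)] -/
private theorem particleHole_hubbardTorusTT'_neg' (hL : Even L) (t t' U : ℝ) :
    particleHole (fun i : Orb (FermionTorus 2 L) => ((torusStagger (ofLex i).1 : ℤ) : ℂ)) *
        hubbardTorusTT' L t (-t') U *
        (particleHole (fun i : Orb (FermionTorus 2 L) => ((torusStagger (ofLex i).1 : ℤ) : ℂ)))ᴴ =
      hubbardTorusTT' L t t' U - (U : ℂ) • totalNumber +
        ((U * L ^ 2 : ℝ) : ℂ) • (1 : Matrix (Finset (Orb (FermionTorus 2 L))) (Finset (Orb (FermionTorus 2 L))) ℂ) := by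
  have h := particleHole_hubbardTorusTT' hL t (-t') U
  rw [neg_neg] at h
  convert h using 4

/-- **Sector ground states of the `t–t'` torus under the staggered particle–hole unitary** (`L` even, `N ≤ 2L²`,
any `S^z = M`): if `ψ` is a unit ground state of `hubbardTorusTT' L t t' U` in the sector `(N, M)`, then `P_Lᴴψ` is
a unit ground state of `hubbardTorusTT' L t (-t') U` in the reflected sector `(2L² - N, -M)` — hole doping at `t'`
is electron doping at `-t'`, sector by sector (the finite-volume statement behind `energyDensityTT'_particleHole`).
[cite: LiebWuPhysicaA2003, §1 eq. (3)] [cite: EsslerEtAl2005, §2.2.4 eqs. (2.59)–(2.61)] -/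
theorem isGroundStateInSector_particleHole_hubbardTorusTT' (hL : Even L) (t t' U : ℝ) {N : ℕ}
    (hN : N ≤ 2 * L ^ 2) {M : ℝ} {ψ : Fock (Orb (FermionTorus 2 L))}
    (hψ : IsGroundStateInSector (hubbardTorusTT' L t t' U) N M ψ) (h1 : star ψ ⬝ᵥ ψ = 1) :
    IsGroundStateInSector (hubbardTorusTT' L t (-t') U) (2 * L ^ 2 - N) (-M)
      ((particleHole (fun i : Orb (FermionTorus 2 L) => ((torusStagger (ofLex i).1 : ℤ) : ℂ)))ᴴ *ᵥ ψ) := by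
  have hcard := card_fermionTorus_two' L
  -- the conjugation identity is handed to the generic transfer lemma through `convert` (the generic lemma derives
  -- its decidability instances from `[LinearOrder] [Fintype]`; instances are subsingletons)
  have h := isGroundStateInSector_conjTranspose_particleHole_mulVec_of_conj
    (fun i : Orb (FermionTorus 2 L) => ((torusStagger (ofLex i).1 : ℤ) : ℂ)) norm_torusPhase
    (H := hubbardTorusTT' L t (-t') U) (H' := hubbardTorusTT' L t t' U) (U := U) (c := U * L ^ 2)
    (by convert particleHole_hubbardTorusTT'_neg' hL t t' U) (N := N) (M := M) (ψ := ψ)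
    (by rw [hcard]; exact hN) hψ h1
  rw [hcard] at h
  exact h

/-- The transformed vector is again a unit vector. [cite: Tasaki2020, §9.3.3] -/
theorem star_conjTranspose_particleHole_mulVec_dotProduct_self_torus (ψ : Fock (Orb (FermionTorus 2 L)))
    (h1 : star ψ ⬝ᵥ ψ = 1) :
    star ((particleHole (fun i : Orb (FermionTorus 2 L) => ((torusStagger (ofLex i).1 : ℤ) : ℂ)))ᴴ *ᵥ ψ) ⬝ᵥ
        ((particleHole (fun i : Orb (FermionTorus 2 L) => ((torusStagger (ofLex i).1 : ℤ) : ℂ)))ᴴ *ᵥ ψ) = 1 := by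
  rw [star_conjTranspose_particleHole_mulVec_dotProduct _ norm_torusPhase, h1]

/-- **Complementary sectors of record.** If `nL²/2` is an integer `m` (`n ≤ 2`), the record half-sector sizes at
`n` and `2 - n` are complementary: `halfRectN (2 - n) L + halfRectN n L = L²` (e.g. `n = 7/8 ↔ 9/8` along `4 ∣ L`,
`n = 17/20 ↔ 23/20` along `20 ∣ L`). [cite: LiebWuPhysicaA2003, §1 eq. (3)] -/
theorem halfRectN_two_sub_add_of_eq {n : ℝ} (hn2 : n ≤ 2) {L m : ℕ} (h : n * (L : ℝ) ^ 2 = 2 * m) :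
    halfRectN (2 - n) L + halfRectN n L = L ^ 2 := by
  have hm : (m : ℝ) ≤ (L : ℝ) ^ 2 := by nlinarith [sq_nonneg (L : ℝ)]
  have hmL : m ≤ L ^ 2 := by exact_mod_cast hm
  have h1 : halfRectN n L = m := by
    rw [halfRectN, h, mul_div_cancel_left₀ _ (two_ne_zero' ℝ), Nat.floor_natCast]
  have h2 : halfRectN (2 - n) L = L ^ 2 - m := by
    rw [halfRectN, show (2 - n) * (L : ℝ) ^ 2 / 2 = (L : ℝ) ^ 2 - m by rw [sub_mul, h]; ring,
      show ((L : ℝ) ^ 2 - m : ℝ) = ((L ^ 2 - m : ℕ) : ℝ) by push_cast [Nat.cast_sub hmL]; ring, Nat.floor_natCast]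
  rw [h1, h2]
  omega

/-- The same for the record particle numbers `rectN = 2 · halfRectN`. [cite: LiebWuPhysicaA2003, §1 eq. (3)] -/
theorem rectN_two_sub_add_of_eq {n : ℝ} (hn2 : n ≤ 2) {L m : ℕ} (h : n * (L : ℝ) ^ 2 = 2 * m) :
    rectN (2 - n) L + rectN n L = 2 * L ^ 2 := by
  have := halfRectN_two_sub_add_of_eq hn2 h
  simp only [rectN, halfRectN] at this ⊢
  omega

end TorusGroundStates

/-! ### §2 The record ground-state class under `α`: hole doping at `t'` IS electron doping at `-t'` -/

namespace InfVolFermionState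

variable {t t' U n : ℝ} {Ls : ℕ → ℕ} {ω : InfVolFermionState 2} {ψ : ∀ L, Fock (Orb (FermionTorus 2 L))}

/-- **The particle–hole transform of a torus-limit ground state of record is a torus-limit ground state of the
reflected model at the reflected density.** Let `ω` be a torus limit, along `Ls → ∞` with `Ls j` eventually even and
complementary record sectors (`halfRectN (2 - n) (Ls j) + halfRectN n (Ls j) = (Ls j)²`, i.e. `n(Ls j)²/2 ∈ ℤ`),
of unit ground states `ψ (Ls j)` of `hubbardTorusTT' (Ls j) t t' U` in the sectors `(rectN n (Ls j), S^z = 0)`,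
`0 ≤ n ≤ 2`. Then there is a family `ψ'` of unit ground states of `hubbardTorusTT' L t (-t') U` in the sectors
`(rectN (2 - n) L, S^z = 0)` (EVERY `L`; along the good sides `ψ' L = P_Lᴴ ψ L`) such that `ω ∘ α` is the torus limit
of `ψ'` along `Ls` — `ω ∘ α` belongs to the record ground-state class at `(t, -t', U, 2 - n)`.
[cite: LiebWuPhysicaA2003, §1 eq. (3)] [cite: BratteliRobinsonI1987, §4.3.1 (PDF pp. 373–375)] -/
theorem IsTorusLimitOf.particleHole_of_sectorGroundStates (t t' U : ℝ) {n : ℝ} (hn0 : 0 ≤ n) (hn2 : n ≤ 2)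
    {Ls : ℕ → ℕ} (heven : ∀ᶠ j in atTop, Even (Ls j))
    (hadd : ∀ᶠ j in atTop, halfRectN (2 - n) (Ls j) + halfRectN n (Ls j) = Ls j ^ 2)
    {ψ : ∀ L, Fock (Orb (FermionTorus 2 L))}
    (hψ : ∀ j, IsGroundStateInSector (hubbardTorusTT' (Ls j) t t' U) (rectN n (Ls j)) 0 (ψ (Ls j)))
    (h1 : ∀ j, star (ψ (Ls j)) ⬝ᵥ ψ (Ls j) = 1) {ω : InfVolFermionState 2} (hω : ω.IsTorusLimitOf ψ Ls) :
    ∃ ψ' : ∀ L, Fock (Orb (FermionTorus 2 L)),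
      (∀ L, IsGroundStateInSector (hubbardTorusTT' L t (-t') U) (rectN (2 - n) L) 0 (ψ' L)) ∧
      (∀ L, star (ψ' L) ⬝ᵥ ψ' L = 1) ∧
      ω.particleHole.IsTorusLimitOf ψ' Ls := by
  classical
  have hn0' : 0 ≤ 2 - n := by linarith
  have hn2' : 2 - n ≤ 2 := by linarith
  -- the good sides: even, complementary sectors, and `ψ L` a unit ground state there
  let good : ℕ → Prop := fun L => Even L ∧ halfRectN (2 - n) L + halfRectN n L = L ^ 2 ∧
    IsGroundStateInSector (hubbardTorusTT' L t t' U) (rectN n L) 0 (ψ L) ∧ star (ψ L) ⬝ᵥ ψ L = 1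
  let ψ' : ∀ L, Fock (Orb (FermionTorus 2 L)) := fun L =>
    if good L then
      (QuantumLattice.particleHole (fun i : Orb (FermionTorus 2 L) => ((torusStagger (ofLex i).1 : ℤ) : ℂ)))ᴴ *ᵥ ψ L
    else Classical.choose (exists_unit_isGroundStateInSector_hubbardTorusTT' L t (-t') U hn0' hn2')
  have hgood : ∀ L, good L →
      IsGroundStateInSector (hubbardTorusTT' L t (-t') U) (rectN (2 - n) L) 0
        ((QuantumLattice.particleHole (fun i : Orb (FermionTorus 2 L) => ((torusStagger (ofLex i).1 : ℤ) : ℂ)))ᴴ *ᵥ ψ L) := by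
    rintro L ⟨hev, hcomp, hgs, hu⟩
    have hle : rectN n L ≤ 2 * L ^ 2 := by simp only [rectN, halfRectN] at hcomp ⊢; omega
    have h := isGroundStateInSector_particleHole_hubbardTorusTT' hev t t' U hle hgs hu
    rwa [show 2 * L ^ 2 - rectN n L = rectN (2 - n) L by simp only [rectN, halfRectN] at hcomp ⊢; omega,
      neg_zero] at h
  refine ⟨ψ', fun L => ?_, fun L => ?_, ?_⟩
  · by_cases hL : good L
    · simp only [ψ', if_pos hL]
      exact hgood L hL
    · simp only [ψ', if_neg hL]
      exact (Classical.choose_spec (exists_unit_isGroundStateInSector_hubbardTorusTT' L t (-t') U hn0' hn2')).1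
  · by_cases hL : good L
    · simp only [ψ', if_pos hL]
      exact star_conjTranspose_particleHole_mulVec_dotProduct_self_torus _ hL.2.2.2
    · simp only [ψ', if_neg hL]
      exact (Classical.choose_spec (exists_unit_isGroundStateInSector_hubbardTorusTT' L t (-t') U hn0' hn2')).2
  · have hlim := hω.particleHole (N := fun j => rectN n (Ls j))
      (fun j => ((mem_szSector_iff _ _ _).1 (hψ j).1).1) heven
    refine hlim.congr_family ?_
    filter_upwards [heven, hadd] with j hev hcomp
    have hL : good (Ls j) := ⟨hev, hcomp, hψ j, h1 j⟩
    simp only [ψ', if_pos hL]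

/-- **Every word for the reflected ground-state class is a word for `ω ∘ α`.** If a property `P` holds for every
torus limit of unit `(rectN (2 - n) L, S^z = 0)`-sector ground states of `hubbardTorusTT' L t (-t') U` along every
`Ls' → ∞` (the binder of the material-oracle `T = 0` words), then `P (ω ∘ α)` for every torus limit `ω` of unit
`(rectN n L, S^z = 0)`-sector ground states of `hubbardTorusTT' L t t' U` along eventually-even `Ls → ∞` with
complementary record sectors. [cite: LiebWuPhysicaA2003, §1 eq. (3)] -/
theorem IsTorusLimitOf.forall_particleHole_of_sectorGroundStates (t t' U : ℝ) {n : ℝ} (hn0 : 0 ≤ n) (hn2 : n ≤ 2)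
    {P : InfVolFermionState 2 → Prop}
    (hP : ∀ (ω' : InfVolFermionState 2) (Ls' : ℕ → ℕ) (ψ' : ∀ L, Fock (Orb (FermionTorus 2 L))),
      Tendsto Ls' atTop atTop →
      (∀ j, IsGroundStateInSector (hubbardTorusTT' (Ls' j) t (-t') U) (rectN (2 - n) (Ls' j)) 0 (ψ' (Ls' j))) →
      (∀ j, star (ψ' (Ls' j)) ⬝ᵥ ψ' (Ls' j) = 1) → ω'.IsTorusLimitOf ψ' Ls' → P ω')
    {Ls : ℕ → ℕ} (hLs : Tendsto Ls atTop atTop) (heven : ∀ᶠ j in atTop, Even (Ls j))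
    (hadd : ∀ᶠ j in atTop, halfRectN (2 - n) (Ls j) + halfRectN n (Ls j) = Ls j ^ 2)
    {ψ : ∀ L, Fock (Orb (FermionTorus 2 L))}
    (hψ : ∀ j, IsGroundStateInSector (hubbardTorusTT' (Ls j) t t' U) (rectN n (Ls j)) 0 (ψ (Ls j)))
    (h1 : ∀ j, star (ψ (Ls j)) ⬝ᵥ ψ (Ls j) = 1) {ω : InfVolFermionState 2} (hω : ω.IsTorusLimitOf ψ Ls) :
    P ω.particleHole := by
  obtain ⟨ψ', hψ', h1', hω'⟩ := hω.particleHole_of_sectorGroundStates t t' U hn0 hn2 heven hadd hψ h1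
  exact hP _ Ls ψ' hLs (fun j => hψ' _) (fun j => h1' _) hω'

/-- **`_of_frequently` form**: only eventually-ODD side sequences (or sides with non-complementary sectors) are
excluded — along any `Ls → ∞` with infinitely many good sides the word transfers after passing to that subsequence
(`P` is a property of the state; `ω` is also the torus limit along the subsequence). [cite: LiebWuPhysicaA2003, §1 eq. (3)] -/
theorem IsTorusLimitOf.forall_particleHole_of_sectorGroundStates_of_frequently (t t' U : ℝ) {n : ℝ} (hn0 : 0 ≤ n)
    (hn2 : n ≤ 2) {P : InfVolFermionState 2 → Prop}
    (hP : ∀ (ω' : InfVolFermionState 2) (Ls' : ℕ → ℕ) (ψ' : ∀ L, Fock (Orb (FermionTorus 2 L))),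
      Tendsto Ls' atTop atTop →
      (∀ j, IsGroundStateInSector (hubbardTorusTT' (Ls' j) t (-t') U) (rectN (2 - n) (Ls' j)) 0 (ψ' (Ls' j))) →
      (∀ j, star (ψ' (Ls' j)) ⬝ᵥ ψ' (Ls' j) = 1) → ω'.IsTorusLimitOf ψ' Ls' → P ω')
    {Ls : ℕ → ℕ} (hLs : Tendsto Ls atTop atTop)
    (hfreq : ∃ᶠ j in atTop, Even (Ls j) ∧ halfRectN (2 - n) (Ls j) + halfRectN n (Ls j) = Ls j ^ 2)
    {ψ : ∀ L, Fock (Orb (FermionTorus 2 L))}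
    (hψ : ∀ j, IsGroundStateInSector (hubbardTorusTT' (Ls j) t t' U) (rectN n (Ls j)) 0 (ψ (Ls j)))
    (h1 : ∀ j, star (ψ (Ls j)) ⬝ᵥ ψ (Ls j) = 1) {ω : InfVolFermionState 2} (hω : ω.IsTorusLimitOf ψ Ls) :
    P ω.particleHole := by
  obtain ⟨φ, hφ, hev⟩ := extraction_of_frequently_atTop hfreq
  exact (hω.comp_tendsto hφ.tendsto_atTop).forall_particleHole_of_sectorGroundStates t t' U hn0 hn2 hP
    (hLs.comp hφ.tendsto_atTop) (Eventually.of_forall fun j => (hev j).1) (Eventually.of_forall fun j => (hev j).2)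
    (fun j => hψ (φ j)) (fun j => h1 (φ j))

/-! ### §3 The dictionary: density `2 - n`, energy `e_{Φ(t,-t',U)}(ω ∘ α) = e_{Φ(t,t',U)}(ω) + U(1 - n)` -/

/-- **Density**: the particle–hole transform of a torus-limit ground state of record at density `n` has density
`2 - n` (no parity needed). [cite: EsslerEtAl2005, §2.2.4 eqs. (2.59)–(2.61)] -/
theorem IsTorusLimitOf.density_particleHole_of_sectorGroundStates (t t' U : ℝ) {n : ℝ} (hn0 : 0 ≤ n)
    {Ls : ℕ → ℕ} (hLs : Tendsto Ls atTop atTop) {ψ : ∀ L, Fock (Orb (FermionTorus 2 L))}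
    (hψ : ∀ j, IsGroundStateInSector (hubbardTorusTT' (Ls j) t t' U) (rectN n (Ls j)) 0 (ψ (Ls j)))
    (h1 : ∀ j, star (ψ (Ls j)) ⬝ᵥ ψ (Ls j) = 1) {ω : InfVolFermionState 2} (hω : ω.IsTorusLimitOf ψ Ls) :
    ω.particleHole.density = 2 - n := by
  rw [density_particleHole, hω.density_eq_of_rectN hLs hn0 (fun j => ((mem_szSector_iff _ _ _).1 (hψ j).1).1) h1]

/-- **Energy**: for `U ≥ 0` and `0 < n < 2`, the particle–hole transform of a torus-limit ground state of record at
`(t, t', U, n)` (eventually-even `Ls → ∞`, complementary sectors) carries the reflected energy density,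
`e_{Φ(t,-t',U)}(ω ∘ α) = e(t, -t', U, 2 - n)`. [cite: Ruelle1969, §3.3] [cite: LiebWuPhysicaA2003, §1 eq. (3)] -/
theorem IsTorusLimitOf.meanEnergy_particleHole_eq_energyDensityTT' (t t' : ℝ) {U : ℝ} (hU : 0 ≤ U) {n : ℝ}
    (hn0 : 0 < n) (hn2 : n ≤ 2) {Ls : ℕ → ℕ} (hLs : Tendsto Ls atTop atTop) (heven : ∀ᶠ j in atTop, Even (Ls j))
    (hadd : ∀ᶠ j in atTop, halfRectN (2 - n) (Ls j) + halfRectN n (Ls j) = Ls j ^ 2)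
    {ψ : ∀ L, Fock (Orb (FermionTorus 2 L))}
    (hψ : ∀ j, IsGroundStateInSector (hubbardTorusTT' (Ls j) t t' U) (rectN n (Ls j)) 0 (ψ (Ls j)))
    (h1 : ∀ j, star (ψ (Ls j)) ⬝ᵥ ψ (Ls j) = 1) {ω : InfVolFermionState 2} (hω : ω.IsTorusLimitOf ψ Ls) :
    ω.particleHole.meanEnergy (hubbardTTPrimeFermionInteraction t (-t') U) 1 = energyDensityTT' t (-t') U (2 - n) := by
  obtain ⟨ψ', hψ', h1', hω'⟩ := hω.particleHole_of_sectorGroundStates t t' U hn0.le hn2 heven hadd hψ h1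
  exact hω'.meanEnergy_hubbardTTPrime_eq_energyDensityTT' t (-t') hU (by linarith) (by linarith) hLs
    (fun j => hψ' _) (fun j => h1' _)

/-- **The `T = 0` mean-energy dictionary**: for `U ≥ 0`, `0 < n < 2` and every torus-limit ground state of record
`ω` at `(t, t', U, n)` along eventually-even `Ls → ∞` with complementary sectors,
`e_{Φ(t,-t',U)}(ω ∘ α) = e_{Φ(t,t',U)}(ω) + U(1 - n)` (`energyDensityTT'_particleHole` read on the two classes).
[cite: LiebWuPhysicaA2003, §1 eq. (3)] [cite: Ruelle1969, §3.3] -/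
theorem IsTorusLimitOf.meanEnergy_particleHole_of_sectorGroundStates (t t' : ℝ) {U : ℝ} (hU : 0 ≤ U) {n : ℝ}
    (hn0 : 0 < n) (hn2 : n < 2) {Ls : ℕ → ℕ} (hLs : Tendsto Ls atTop atTop) (heven : ∀ᶠ j in atTop, Even (Ls j))
    (hadd : ∀ᶠ j in atTop, halfRectN (2 - n) (Ls j) + halfRectN n (Ls j) = Ls j ^ 2)
    {ψ : ∀ L, Fock (Orb (FermionTorus 2 L))}
    (hψ : ∀ j, IsGroundStateInSector (hubbardTorusTT' (Ls j) t t' U) (rectN n (Ls j)) 0 (ψ (Ls j)))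
    (h1 : ∀ j, star (ψ (Ls j)) ⬝ᵥ ψ (Ls j) = 1) {ω : InfVolFermionState 2} (hω : ω.IsTorusLimitOf ψ Ls) :
    ω.particleHole.meanEnergy (hubbardTTPrimeFermionInteraction t (-t') U) 1 =
      ω.meanEnergy (hubbardTTPrimeFermionInteraction t t' U) 1 + U * (1 - n) := by
  rw [hω.meanEnergy_particleHole_eq_energyDensityTT' t t' hU hn0 hn2.le hLs heven hadd hψ h1,
    hω.meanEnergy_hubbardTTPrime_eq_energyDensityTT' t t' hU hn0.le hn2 hLs hψ h1,
    energyDensityTT'_particleHole t t' hU hn0 hn2]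
  ring

/-- **Energy-window transport at `T = 0`**: a certified window `lo ≤ e_{Φ(t,t',U)}(ω) ≤ hi` on the record class
at `(t, t', U, n)` gives `lo + U(1 - n) ≤ e_{Φ(t,-t',U)}(ω ∘ α) ≤ hi + U(1 - n)` (`U ≥ 0`, `0 < n < 2`).
[cite: LiebWuPhysicaA2003, §1 eq. (3)] -/
theorem IsTorusLimitOf.meanEnergy_particleHole_mem_Icc_of_window (t t' : ℝ) {U : ℝ} (hU : 0 ≤ U) {n : ℝ}
    (hn0 : 0 < n) (hn2 : n < 2) {Ls : ℕ → ℕ} (hLs : Tendsto Ls atTop atTop) (heven : ∀ᶠ j in atTop, Even (Ls j))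
    (hadd : ∀ᶠ j in atTop, halfRectN (2 - n) (Ls j) + halfRectN n (Ls j) = Ls j ^ 2)
    {ψ : ∀ L, Fock (Orb (FermionTorus 2 L))}
    (hψ : ∀ j, IsGroundStateInSector (hubbardTorusTT' (Ls j) t t' U) (rectN n (Ls j)) 0 (ψ (Ls j)))
    (h1 : ∀ j, star (ψ (Ls j)) ⬝ᵥ ψ (Ls j) = 1) {ω : InfVolFermionState 2} (hω : ω.IsTorusLimitOf ψ Ls)
    {lo hi : ℝ} (hlo : lo ≤ ω.meanEnergy (hubbardTTPrimeFermionInteraction t t' U) 1)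
    (hhi : ω.meanEnergy (hubbardTTPrimeFermionInteraction t t' U) 1 ≤ hi) :
    ω.particleHole.meanEnergy (hubbardTTPrimeFermionInteraction t (-t') U) 1 ∈
      Set.Icc (lo + U * (1 - n)) (hi + U * (1 - n)) := by
  rw [hω.meanEnergy_particleHole_of_sectorGroundStates t t' hU hn0 hn2 hLs heven hadd hψ h1]
  exact ⟨by linarith, by linarith⟩

end InfVolFermionState

end Literature.MathematicalPhysics.QuantumLattice
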